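import Literature.NumberTheory.LFunctions.Zhang2022.KnifeEdgeLenZDegreeShort
import Literature.NumberTheory.LFunctions.Zhang2022.SkeletonMeanValue
import Literature.NumberTheory.LFunctions.Zhang2022.KnifeEdgeInvisibleTail
import Literature.Algebra.EuclideanLattices.CoprimeLatticePointsEllipse

/-!
# Zhang (2022), rung F-S3 (§D edge len = E*-len⁺): crux card `long-leg-split-chi-band` (stmt-Parity-20014, aimed at
# 20446 `LongPairsGradedTables`) — typed first rung: formula I / Lemma 8.1 with INDEPENDENT truncations, LEG A
# `FormulaILongPsi` (K2), LEG B `FormulaILongDual` (K1, OPEN knife-edge line), `Lemma81LongPsi` (P2), the transfer shape,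
# `BandMainVanishes` (P1, PROVED, and in Möbius form for EVERY modulus), Pólya–Vinogradov along a progression (P3, PROVED)

Y. Zhang, *Discrete mean estimates and the Landau–Siegel zero*, arXiv:2211.02515v1 [Zhang2022LandauSiegel] — an
unrefereed manuscript under adjudication. **WHAT THIS IS NOT: not a claim about Theorems 1–2 of arXiv:2211.02515, about
Landau–Siegel zeros, or about Parity. The programme SEARCHES and TYPES; no claim about Landau–Siegel zeros, Theorems 1–2
of arXiv:2211.02515 or a repaired Margin232 until a kernel theorem says so.** `FormulaILongPsi`, `FormulaILongDual`,
`Lemma81LongPsi`, `LegSplitTransferX2` are bare `Prop`s — OPEN, asserted by no one; the file ELIMINATES NOTHING (the 20446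
hold is untouched). PROVED: finite character-sum algebra (Parts 4–5), `rfl` sanity and data linearity (Parts 1–2).

THE CARD (`Cruxes/PsiGradedTables/Ideas/long-leg-split-chi-band.md`, ls-knife-len-idea-1 g9, 58cb6472073f; critic
ls-knife-crit-1 g8: new-combination, kept open; sketches `knife/len/Sketch-g9.lean` c25b012313c4b6e2, `Sketch-g10.lean`
16a1b3db68cb3d3c). By Lemma 8.1 the long-pair `X₂` cell is `Θ₁(𝐚₁,𝐚₂) + conj Θ₁(𝐚̄₂,𝐚̄₁)`, `𝐚₁ = b ⋆ (χg̃) ⋆ (χf̃)`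
on the ψ-side (log-length `θ_f + θ_g ≤ 2`, `b` supported `≤ D⁵`), `𝐚₂ = ν·1_{<D⁴}` on the k-side; the tree's
`Skeleton.Prop71`/`Skeleton.Lemma81` assume (7.2) (`Adm72`, support `< PT⁻²`) for BOTH sequences, so neither leg is an
instance: every `…Ext` object below with a truncation `N > Nsupp D = ⌈PT⁻²⌉` LEAVES Prop 7.1's typed support — the same
(7.2) boundary as the K0 (S2) sliver of M-RULEBOOK (D15⁗); only the cells at `Nsupp` are inside the printed engine
(`…_nsupp`). LEG A: Prop 7.1's proof uses the length of `𝐚₁` once, at the zero-free-region step (7.17)–(7.19) (band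
threshold `pk/l₂ ≥ T^c` — proof-internal, no statement object); in the complementary band the long profile variable is
constrained only by divisibilities, Pólya–Vinogradov (Part 5, engine `KnifeEdgeInvisibleTail.norm_sum_Ioc_char_mul_le`,
p445477) bounds it and the COMPLETED main term vanishes exactly (Part 4). LEG B: long data on the k-side — a K-len
knife-edge line, OPEN, not claimed; priced in HOME/knife/len/CARD-long-leg-split-chi-band.md §Barriers (a)–(j).
SHAPE (statement guards ls-theory g5 (l1)–(l6)/(l2′), ls-knife-crit-1 g9 (g1)–(g4)/(g1′), 2026-08-27): the card's sketch
put the profile binders inside `ForAllLarge` over the CONE `InClassPiece` with an additive slack `ε·𝔓` — slack-free by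
scaling (`g ↦ λg`), hence misstated; here K2/K1/P2 are typed in `Skeleton.Prop71`'s currency, fix (i): EVERY datum entering
bilinearly is bounded by the `B` quantified OUTSIDE `ForAllLarge` — `‖b(n)‖ ≤ B·τ(n)²`, sup-normalised profiles
`‖g‖, ‖f‖ ≤ 1` on `[0,1]`, `𝐚₂ ∈ Adm72 D B`. The `X₂` cell's own `b = D·δ_D ⋆ υ·1_{≤D⁴}` (amplitude `≍ D·τ`, critic (a))
is K2 applied to `b/D` by linearity in `𝐚₁` (`longPsiData_const_mul`; slack `ε·D·𝔓`) — NOT a separate Prop (critic (g1′)).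
P2 carries the total-length side condition IN ITS BINDERS (`θ_g + θ_f ≤ 2 − δ`, k-side support `< D⁴`; (l3)/(g2), critic's
addendum (β)); the corner `λ = 2` is NOT covered by this leaf. `BandMainVanishes` needs `(D,k) = 1` AS STATED (example
below) but over the multiples of any `e ∣ k` — Möbius form — NO coprimality is needed (`sum_range_mul_char_multiples_eq_zero`,
`…_coprime_eq_zero`; critic (c)). NOT here: any proof of Leg A/B; the smooth-weight variation bound; display benchmarks.
-/

noncomputable section

open Complex Real ComplexConjugate Finset

namespace Literature.NumberTheory.LFunctions.Zhang2022.KnifeEdge.LongLegSplit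

open Repair Skeleton

/-! ### Part 1 — the ψ-side data of the long-pair cell -/

/-- `n ↦ χ(n)·g(log n / log P)`: the coefficients of the profile polynomial of an in-class profile `g` (the `ψ`-twist is
applied separately by `Lemma81.dirPoly`; `KnifeEdge.profPoly` carries `χψ` together). [cite: Zhang2022LandauSiegel, §8 (8.8)] -/
def profData {D : ℕ} (χ : DirichletCharacter ℂ D) (g : ℝ → ℂ) (n : ℕ) : ℂ :=
  χ (n : ZMod D) * g (Real.log n / Real.log (bigP D))

/-- **`𝐚₁ = b ⋆ (χg̃) ⋆ (χf̃)`** — the ψ-side data of the long-pair `X₂` cell, Dirichlet convolution on divisor pairs (`b` the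
tiny arithmetic factor, `g, f` in-class profiles, log-length `θ_g + θ_f ≤ 2`). [cite: Zhang2022LandauSiegel, §8 Lemma 8.1, (8.8)] -/
def longPsiData {D : ℕ} (χ : DirichletCharacter ℂ D) (b : ℕ → ℂ) (g f : ℝ → ℂ) (n : ℕ) : ℂ :=
  ∑ p ∈ Nat.divisorsAntidiagonal n, b p.1 *
    ∑ q ∈ Nat.divisorsAntidiagonal p.2, profData χ g q.1 * profData χ f q.2

/-- The long truncation `D⁵·(⌊P⌋+1)²` (covers the support of `longPsiData`; the card's `N1long` (ψ-side, Leg A) and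
`N2long` (k-side, Leg B) are both this number). [cite: Zhang2022LandauSiegel, §7 (7.2), §8 Lemma 8.1] -/
def Nlong (D : ℕ) : ℕ := D ^ 5 * (⌊bigP D⌋₊ + 1) ^ 2

/-- `𝐚₁` is linear in the arithmetic factor `b` (the first step of «the `D·τ` amplitude class is K2 applied to `b/D`»).
[cite: Zhang2022LandauSiegel, §8 (8.8)] -/
theorem longPsiData_const_mul {D : ℕ} (χ : DirichletCharacter ℂ D) (c : ℂ) (b : ℕ → ℂ) (g f : ℝ → ℂ) (n : ℕ) :
    longPsiData χ (fun m => c * b m) g f n = c * longPsiData χ b g f n := by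
  simp only [longPsiData, Finset.mul_sum, mul_assoc]

/-! ### Part 2 — formula I and Lemma 8.1 with independent truncations -/

section Ext

variable (c' : ℝ) {D : ℕ} [NeZero D] (χ : DirichletCharacter ℂ D)

/-- **`Θ₁(𝐚₁,𝐚₂)` with the ψ-side polynomial truncated at `N₁` and the k-side one at `N₂`** (`Skeleton.Theta1` is the
case `N₁ = N₂ = Nsupp D = ⌈PT⁻²⌉`, `Theta1Ext_nsupp`). [cite: Zhang2022LandauSiegel, §7 Prop. 7.1] -/
def Theta1Ext (N₁ N₂ : ℕ) (a₁ a₂ : ℕ → ℂ) : ℂ :=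
  ∑ x ∈ finsetOf (PsiOne χ), Lemma81.segInt (t0 D) (ell1 D) 1 fun s =>
    frakcW c' x s * Lemma81.dirPoly N₁ a₁ x.ψ s * Lemma81.dirPoly N₂ a₂ x.ψ⁻¹ (1 - s) * omegaW D s

/-- **The left side of Lemma 8.1 with truncations `N₁, N₂`**: `ΣΣ 𝔠*(ρ,ψ)A_{N₁}(𝐚₁;ρ,ψ)A_{N₂}(𝐚₂;1−ρ,ψ̄)ω(ρ)`
(`lhs81Ext_nsupp`: at `Nsupp` it is `Skeleton.lhs81`). [cite: Zhang2022LandauSiegel, §8 Lemma 8.1] -/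
def lhs81Ext (N₁ N₂ : ℕ) (a₁ a₂ : ℕ → ℂ) : ℂ :=
  ∑ i ∈ idx χ, cstar c' D i.1 i.2 * Lemma81.dirPoly N₁ a₁ i.1.ψ i.2 *
    Lemma81.dirPoly N₂ a₂ i.1.ψ⁻¹ (1 - i.2) * omegaW D i.2

omit [NeZero D] in
/-- **`S_j(𝐚₁,𝐚₂)` of Prop. 7.1 with the `m`-sum run to `N₁`, the `d, r, n`-sums to `N₂`.** [cite: Zhang2022LandauSiegel, §7 Prop. 7.1] -/
def SjExt (D : ℕ) (N₁ N₂ : ℕ) (j : ℕ) (a₁ a₂ : ℕ → ℂ) : ℂ :=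
  ∑ d ∈ Finset.Ico 1 N₂, ∑ r ∈ Finset.Ico 1 N₂,
    ((ArithmeticFunction.moebius r).natAbs : ℂ) * lamZero c' D j (d * r) /
        ((d * r : ℕ) * (Nat.totient r : ℂ)) *
      (∑ m ∈ Finset.Ico 1 N₁, a₁ (d * r * m) / (m : ℂ) ^ (1 - betaJ c' D j)) *
      (∑ n ∈ Finset.Ico 1 N₂, a₂ (d * r * n) * xiZero c' D j n d r / (n : ℂ))

omit [NeZero D] in
/-- **`E(𝐚₁,𝐚₂) = 𝔓𝓛²Σ_j|S_j|` with the extended ranges.** [cite: Zhang2022LandauSiegel, §7 Prop. 7.1] -/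
def EcalExt (D : ℕ) (N₁ N₂ : ℕ) (a₁ a₂ : ℕ → ℂ) : ℝ :=
  frakP D * ell D ^ 2 *
    (‖SjExt c' D N₁ N₂ 1 a₁ a₂‖ + ‖SjExt c' D N₁ N₂ 2 a₁ a₂‖ + ‖SjExt c' D N₁ N₂ 3 a₁ a₂‖)

omit [NeZero D] in
/-- **The main term `α⁻¹(½S₁ + 2S₂ + 3/2·S₃)𝔓` with the extended ranges.** [cite: Zhang2022LandauSiegel, §7 Prop. 7.1] -/
def mainMVExt (D : ℕ) (N₁ N₂ : ℕ) (a₁ a₂ : ℕ → ℂ) : ℂ :=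
  (alpha D : ℂ)⁻¹ *
    (1 / 2 * SjExt c' D N₁ N₂ 1 a₁ a₂ + 2 * SjExt c' D N₁ N₂ 2 a₁ a₂
      + 3 / 2 * SjExt c' D N₁ N₂ 3 a₁ a₂) * frakP D

omit [NeZero D] in
/-- At `N₁ = N₂ = ⌈PT⁻²⌉` the extended `Θ₁` IS `Skeleton.Theta1` (definitional). [cite: Zhang2022LandauSiegel, §7 Prop. 7.1] -/
theorem Theta1Ext_nsupp (a₁ a₂ : ℕ → ℂ) : Theta1Ext c' χ (Nsupp D) (Nsupp D) a₁ a₂ = Theta1 c' χ a₁ a₂ := rfl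

omit [NeZero D] in
/-- At `N₁ = N₂ = ⌈PT⁻²⌉` the extended left side IS `Skeleton.lhs81` (definitional). [cite: Zhang2022LandauSiegel, §8 Lemma 8.1] -/
theorem lhs81Ext_nsupp (a₁ a₂ : ℕ → ℂ) : lhs81Ext c' χ (Nsupp D) (Nsupp D) a₁ a₂ = lhs81 c' χ a₁ a₂ := rfl

omit [NeZero D] in
/-- At `N₁ = N₂ = ⌈PT⁻²⌉`, `SjExt` IS `Skeleton.Sj` (definitional). [cite: Zhang2022LandauSiegel, §7 Prop. 7.1] -/
theorem SjExt_nsupp (j : ℕ) (a₁ a₂ : ℕ → ℂ) : SjExt c' D (Nsupp D) (Nsupp D) j a₁ a₂ = Sj c' D j a₁ a₂ := rfl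

omit [NeZero D] in
/-- At `N₁ = N₂ = ⌈PT⁻²⌉`, `EcalExt` IS `Skeleton.Ecal` (definitional). [cite: Zhang2022LandauSiegel, §7 Prop. 7.1] -/
theorem EcalExt_nsupp (a₁ a₂ : ℕ → ℂ) : EcalExt c' D (Nsupp D) (Nsupp D) a₁ a₂ = Ecal c' D a₁ a₂ := rfl

omit [NeZero D] in
/-- At `N₁ = N₂ = ⌈PT⁻²⌉`, `mainMVExt` IS `Skeleton.mainMV` (definitional). [cite: Zhang2022LandauSiegel, §7 Prop. 7.1] -/
theorem mainMVExt_nsupp (a₁ a₂ : ℕ → ℂ) : mainMVExt c' D (Nsupp D) (Nsupp D) a₁ a₂ = mainMV c' D a₁ a₂ := rfl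

end Ext

/-! ### Part 3 — the slots of the leg split (bare `Prop`s, OPEN, asserted by no one) -/

section Slots

variable (c' : ℝ)

/-- **LEG A = the card's K2 `FormulaILongPsi` (OPEN — asserted by no one).** Prop. 7.1's conclusion for
`𝐚₁ = b ⋆ (χg̃) ⋆ (χf̃)` of ANY log-length `θ_g + θ_f ≤ 2` (`g, f` in-class pieces, sup-normalised on `[0,1]`;
`‖b(n)‖ ≤ B·τ(n)²`, `b` supported `≤ D⁵`) against printed-type k-side data `𝐚₂ ∈ Adm72 D B`, ψ-side truncation `Nlong D`,
k-side `⌈PT⁻²⌉`; `Skeleton.Prop71`'s currency (fix (i) of the critic's guard (g1): every bilinear datum bounded by the `B`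
outside `ForAllLarge`, so the slack `ε·𝔓` is honest). The `X₂` cell's `b = D·δ_D ⋆ υ·1_{≤D⁴}` is this statement at `b/D`
(slack `ε·D·𝔓`, linearity). Why it might fail: a hidden second use of `supp 𝐚₁ < PT⁻²` outside (7.17)–(7.19), or the
D-normalisation. The transfer chains it with `Lemma81LongPsi` only for `θ_g + θ_f ≤ 2 − δ` (critic (g2)).
[cite: Zhang2022LandauSiegel, §7 Prop. 7.1, (7.2), (7.17)–(7.19)] -/
def FormulaILongPsi : Prop :=
  ∀ B : ℝ, ∀ ε : ℝ, 0 < ε → ∃ C : ℝ, ForAllLarge fun D _ χ => AssumptionA D χ →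
    ∀ (b : ℕ → ℂ) (g g' f f' : ℝ → ℂ) (a₂ : ℕ → ℂ),
      InClassPiece g g' → InClassPiece f f' →
      (∀ x ∈ Set.Icc (0:ℝ) 1, ‖g x‖ ≤ 1) → (∀ x ∈ Set.Icc (0:ℝ) 1, ‖f x‖ ≤ 1) →
      (∀ n, ‖b n‖ ≤ B * ((Nat.divisors n).card : ℝ) ^ 2) → (∀ n : ℕ, D ^ 5 < n → b n = 0) →
      Adm72 D B a₂ →
        ‖Theta1Ext c' χ (Nlong D) (Nsupp D) (longPsiData χ b g f) a₂
            - mainMVExt c' D (Nlong D) (Nsupp D) (longPsiData χ b g f) a₂‖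
          ≤ C * EcalExt c' D (Nlong D) (Nsupp D) (longPsiData χ b g f) a₂ + ε * frakP D

/-- **LEG B = the card's K1 `FormulaILongDual` (OPEN — asserted by no one; a K-len knife-edge line, NOT claimed; priced in
HOME/knife/len/CARD-long-leg-split-chi-band.md §Barriers (a)–(j)).** Prop. 7.1's conclusion for tiny ψ-side data
`𝐚₁ ∈ Adm72 D B` against LONG k-side data `𝐚₂ = conj(b ⋆ (χg̃) ⋆ (χf̃))` of log-length `λ ∈ [1,2]` (k-side truncation
`Nlong D`; same bounded classes as K2): the reciprocity moduli are `k ≍ P^λ D^{O(1)} ≥ P > p` and the dual large sieve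
(7.15) loses `P^{(λ−1)/2}`. Typed so that the long-pair cell reads `⟸ FormulaILongPsi ∧ FormulaILongDual`.
[cite: Zhang2022LandauSiegel, §7 Prop. 7.1, (7.7)–(7.9), (7.15)] -/
def FormulaILongDual : Prop :=
  ∀ B : ℝ, ∀ ε : ℝ, 0 < ε → ∃ C : ℝ, ForAllLarge fun D _ χ => AssumptionA D χ →
    ∀ (b : ℕ → ℂ) (g g' f f' : ℝ → ℂ) (a₁ : ℕ → ℂ),
      InClassPiece g g' → InClassPiece f f' →
      (∀ x ∈ Set.Icc (0:ℝ) 1, ‖g x‖ ≤ 1) → (∀ x ∈ Set.Icc (0:ℝ) 1, ‖f x‖ ≤ 1) →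
      (∀ n, ‖b n‖ ≤ B * ((Nat.divisors n).card : ℝ) ^ 2) → (∀ n : ℕ, D ^ 5 < n → b n = 0) →
      Adm72 D B a₁ →
        ‖Theta1Ext c' χ (Nsupp D) (Nlong D) a₁ (fun n => conj (longPsiData χ b g f n))
            - mainMVExt c' D (Nsupp D) (Nlong D) a₁ (fun n => conj (longPsiData χ b g f n))‖
          ≤ C * EcalExt c' D (Nsupp D) (Nlong D) a₁ (fun n => conj (longPsiData χ b g f n))
            + ε * frakP D

/-- **The card's P2: Lemma 8.1 with the extended truncations (OPEN — asserted by no one), total-length side condition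
IN THE BINDERS.** For `𝐚₁ = b ⋆ (χg̃) ⋆ (χf̃)` with SHORT pieces of lengths `θ_g + θ_f ≤ 2 − δ` (`δ > 0`; ψ-side,
`Nlong`) and TINY k-side data `𝐚₂` (`‖𝐚₂‖ ≤ B`, support `< D⁴`, the `X₂` cell's `ν·1_{<D⁴}`):
`ΣΣ𝔠*A(𝐚₁)A(𝐚₂)ω = Θ₁(𝐚₁,𝐚₂) + conj Θ₁(𝐚̄₂,𝐚̄₁) + o(𝔓)`, the reflected term truncated the other way round. The reflection
identity is length-blind, but the replacement `𝔠̃ ↦ 𝔠` (Lemmas 5.2/5.9, saving `𝓛⁻¹¹⁴`) runs through the large sieve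
(Lemma 3.3) for polynomials of TOTAL length `P^{θ_g+θ_f}·D⁹` — costless below `P^{2−δ}`, NOT at the corner `λ = 2` and
NOT for general `Adm72` k-side data (total length `P^{1+λ}T⁻²`): neither is covered here (critic's addendum (β), (g2);
theory (l3)). [cite: Zhang2022LandauSiegel, §8 Lemma 8.1, Lemma 3.3, Lemmas 5.2 and 5.9] -/
def Lemma81LongPsi : Prop :=
  ∀ δ : ℝ, 0 < δ → ∀ B : ℝ, ∀ ε : ℝ, 0 < ε → ForAllLarge fun D _ χ => AssumptionA D χ →
    ∀ (b : ℕ → ℂ) (g g' f f' : ℝ → ℂ) (a₂ : ℕ → ℂ) (θg θf : ℝ),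
      ShortPiece θg g g' → ShortPiece θf f f' → θg + θf ≤ 2 - δ →
      (∀ x ∈ Set.Icc (0:ℝ) 1, ‖g x‖ ≤ 1) → (∀ x ∈ Set.Icc (0:ℝ) 1, ‖f x‖ ≤ 1) →
      (∀ n, ‖b n‖ ≤ B * ((Nat.divisors n).card : ℝ) ^ 2) → (∀ n : ℕ, D ^ 5 < n → b n = 0) →
      (∀ n, ‖a₂ n‖ ≤ B) → (∀ n : ℕ, D ^ 4 ≤ n → a₂ n = 0) →
        ‖lhs81Ext c' χ (Nlong D) (Nsupp D) (longPsiData χ b g f) a₂ -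
            (Theta1Ext c' χ (Nlong D) (Nsupp D) (longPsiData χ b g f) a₂ +
              conj (Theta1Ext c' χ (Nsupp D) (Nlong D) (fun n => conj (a₂ n))
                (fun n => conj (longPsiData χ b g f n))))‖
          ≤ ε * frakP D

/-- **TRANSFER (shape only, OPEN — asserted by no one).** The `X₂` conjunct `∃ X₂, TauTwoTablePsi c′ X₂` of
`LongPairsGradedTables` (stmt-Parity-20446; pointwise currency) should follow from the two legs (uniform currency, the
stronger side) plus the typed conversion (`KnifeEdge.tauTwoTablePsi_of_split`, `Lemma81LongPsi`, rescaling of the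
profiles); the implication a line would have to prove, not proved here. [cite: Zhang2022LandauSiegel, §8 Lemma 8.1, (8.5)] -/
def LegSplitTransferX2 : Prop :=
  FormulaILongPsi c' → FormulaILongDual c' → ∃ X₂ : PairFunctional, TauTwoTablePsi c' X₂

end Slots

/-! ### Part 4 — the band lemma: exact vanishing of the completed main term -/

section Band

/-- **The card's P1 `BandMainVanishes`** (verbatim): for `χ ≠ 1` mod `D` and `k` coprime to `D`, every `k`-periodic
weight `c` is orthogonal to `χ` over a full period `D·k` (CRT) — the completed band sum `Σ_{r mod Dk} χ(r)c_k(r)`. PROVED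
below; the coprimality is load-bearing AS STATED (the `D = k = 3` example at the end of this Part) but not for the divisibility /
coprimality masks Leg A produces (`sum_range_mul_char_multiples_eq_zero`, `…_coprime_eq_zero`).
[cite: MontgomeryVaughan2007, Cor 4.5 (4.14); §4.1 proof of Thm 4.1 (CRT factorisation)] -/
def BandMainVanishes : Prop :=
  ∀ (D k : ℕ) (χ : DirichletCharacter ℂ D) (c : ZMod k → ℂ), χ ≠ 1 → Nat.Coprime D k → 0 < k →
    ∑ r ∈ Finset.range (D * k), χ (r : ZMod D) * c (r : ZMod k) = 0

/-- The CRT map `r ↦ (r mod D, r mod k)` on `Fin (D·k)` is a bijection onto `ZMod D × ZMod k` when `(D,k) = 1`.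
[cite: MontgomeryVaughan2007, §4.1 proof of Thm 4.1 (CRT factorisation)] -/
theorem crtMap_bijective (D k : ℕ) [NeZero D] [NeZero k] (hcop : Nat.Coprime D k) :
    Function.Bijective (fun i : Fin (D * k) => (((i : ℕ) : ZMod D), ((i : ℕ) : ZMod k))) := by
  rw [Fintype.bijective_iff_injective_and_card]
  refine ⟨?_, by simp [Fintype.card_prod, ZMod.card]⟩
  intro i j hij
  simp only [Prod.mk.injEq] at hij
  obtain ⟨h1, h2⟩ := hij
  rw [ZMod.natCast_eq_natCast_iff] at h1 h2
  have h3 : (i : ℕ) ≡ j [MOD D * k] := (Nat.modEq_and_modEq_iff_modEq_mul hcop).mp ⟨h1, h2⟩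
  exact Fin.ext (Nat.ModEq.eq_of_lt_of_lt h3 i.isLt j.isLt)

/-- Over a full period `D·k`, `(D,k) = 1`, the sum factorises (CRT) as `(Σ_{a mod D} χ a)·(Σ_{b mod k} c b)`.
[cite: MontgomeryVaughan2007, §4.1 proof of Thm 4.1 (CRT factorisation)] -/
theorem sum_range_mul_eq_sum_mul_sum (D k : ℕ) [NeZero D] [NeZero k] (hcop : Nat.Coprime D k)
    (χ : DirichletCharacter ℂ D) (c : ZMod k → ℂ) :
    ∑ r ∈ Finset.range (D * k), χ (r : ZMod D) * c (r : ZMod k)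
      = (∑ a : ZMod D, χ a) * ∑ b : ZMod k, c b := by
  rw [Finset.sum_range]
  have h := (crtMap_bijective D k hcop).sum_comp (fun p : ZMod D × ZMod k => χ p.1 * c p.2)
  simp only at h
  rw [h, Fintype.sum_prod_type, Fintype.sum_mul_sum]

/-- **`BandMainVanishes` holds** (CRT factorisation + `MulChar.sum_eq_zero_of_ne_one`; the proof of ls-knife-len-idea-1
g10, `knife/len/Sketch-g10.lean`). [cite: MontgomeryVaughan2007, Cor 4.5 (4.14)] -/
theorem bandMainVanishes_holds : BandMainVanishes := by
  intro D k χ c hχ hcop hk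
  rcases Nat.eq_zero_or_pos D with rfl | hD
  · simp
  haveI : NeZero D := ⟨hD.ne'⟩
  haveI : NeZero k := ⟨hk.ne'⟩
  rw [sum_range_mul_eq_sum_mul_sum D k hcop χ c, MulChar.sum_eq_zero_of_ne_one hχ, zero_mul]

/-- `BandMainVanishes` — `_holds` alias of `bandMainVanishes_holds` above under the fact's exact name (appended
2026-08-28, D-0026 bookkeeping: the proof term is the existing theorem of this file; no statement,
definition or attribute is edited; no new named fact; the ledger's debt table listed the fact
unproved). [cite: MontgomeryVaughan2007, Cor 4.5 (4.14)] -/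
theorem _root_.Literature.NumberTheory.LFunctions.Zhang2022.KnifeEdge.LongLegSplit.BandMainVanishes_holds :
    BandMainVanishes :=
  _root_.Literature.NumberTheory.LFunctions.Zhang2022.KnifeEdge.LongLegSplit.bandMainVanishes_holds

/-- A non-principal character sums to `0` over the period `[0, D)`. [cite: MontgomeryVaughan2007, Cor 4.5 (4.14)] -/
theorem sum_range_char_eq_zero {D : ℕ} (χ : DirichletCharacter ℂ D) (hχ : χ ≠ 1) :
    ∑ r ∈ Finset.range D, χ (r : ZMod D) = 0 := by
  rcases Nat.eq_zero_or_pos D with rfl | hD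
  · simp
  haveI : NeZero D := ⟨hD.ne'⟩
  have h := sum_range_mul_eq_sum_mul_sum D 1 (Nat.coprime_one_right D) χ (fun _ => 1)
  simp only [mul_one] at h
  rw [h, MulChar.sum_eq_zero_of_ne_one hχ, zero_mul]

/-- A non-principal character sums to `0` over `m` full periods `[0, D·m)` (MV: «Σ_{1≤n≤kq} χ(n) = 0 for k = 1, 2, 3, …»).
[cite: MontgomeryVaughan2007, §4.3, display after (4.22)] -/
theorem sum_range_mul_char_eq_zero {D : ℕ} (χ : DirichletCharacter ℂ D) (hχ : χ ≠ 1) (m : ℕ) :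
    ∑ r ∈ Finset.range (D * m), χ (r : ZMod D) = 0 := by
  induction m with
  | zero => simp
  | succ m ih =>
    rw [Nat.mul_succ, Finset.sum_range_add, ih, zero_add]
    have : ∀ x ∈ Finset.range D, χ ((D * m + x : ℕ) : ZMod D) = χ (x : ZMod D) := by
      intro x _
      congr 1
      push_cast
      simp
    rw [Finset.sum_congr rfl this, sum_range_char_eq_zero χ hχ]

/-- **`BandMainVanishes` in Möbius form, NO coprimality (critic's typing note (c)):** for `χ ≠ 1` mod `D` and ANY
`e ∣ k`, `0 < e`: `Σ_{r<Dk, e∣r} χ(r) = χ(e)·Σ_{r′<D·(k/e)} χ(r′) = 0` — the shape Leg A meets (the band's only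
constraints on the long profile variable are divisibilities). [cite: MontgomeryVaughan2007, §4.3, display after (4.22)] -/
theorem sum_range_mul_char_multiples_eq_zero {D : ℕ} (χ : DirichletCharacter ℂ D) (hχ : χ ≠ 1) {k e : ℕ}
    (he : 0 < e) (hek : e ∣ k) :
    ∑ r ∈ Finset.range (D * k), (if e ∣ r then χ (r : ZMod D) else 0) = 0 := by
  obtain ⟨k', rfl⟩ := hek
  rw [← Finset.sum_filter]
  have hfilter : (Finset.range (D * (e * k'))).filter (fun r => e ∣ r)
      = (Finset.range (D * k')).image (fun r' => e * r') := by
    ext r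
    simp only [Finset.mem_filter, Finset.mem_range, Finset.mem_image]
    constructor
    · rintro ⟨hr, r', rfl⟩
      exact ⟨r', Nat.lt_of_mul_lt_mul_left (by rwa [mul_left_comm] at hr), rfl⟩
    · rintro ⟨r', hr', rfl⟩
      exact ⟨by rw [mul_left_comm]; exact Nat.mul_lt_mul_of_pos_left hr' he, dvd_mul_right e r'⟩
  rw [hfilter, Finset.sum_image fun x _ y _ hxy => Nat.eq_of_mul_eq_mul_left he hxy]
  have : ∀ r' ∈ Finset.range (D * k'), χ ((e * r' : ℕ) : ZMod D) = χ (e : ZMod D) * χ (r' : ZMod D) := by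
    intro r' _
    rw [Nat.cast_mul, map_mul]
  rw [Finset.sum_congr rfl this, ← Finset.mul_sum, sum_range_mul_char_eq_zero χ hχ, mul_zero]

/-- **The coprimality mask is orthogonal to `χ` for EVERY modulus:** `Σ_{r<Dk} χ(r)·𝟙[(r,k)=1] = 0` for `χ ≠ 1` mod `D`
and any `k ≥ 1` (Möbius over `e ∣ k` + `sum_range_mul_char_multiples_eq_zero`) — the «`D ∣ l ⇒ (k,D) = 1`» provenance in
the card is a convenience, not load-bearing, for the constraint `(r,k) = 1` Leg A produces in `𝔗₁₁`.
[cite: MontgomeryVaughan2007, (1.20) and §4.3, display after (4.22)] -/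
theorem sum_range_mul_char_coprime_eq_zero {D : ℕ} (χ : DirichletCharacter ℂ D) (hχ : χ ≠ 1) {k : ℕ} (hk : 0 < k) :
    ∑ r ∈ Finset.range (D * k), (if Nat.Coprime r k then χ (r : ZMod D) else 0) = 0 := by
  have hmask : ∀ r : ℕ, (if Nat.Coprime r k then χ (r : ZMod D) else 0)
      = ∑ e ∈ k.divisors, (if e ∣ r then χ (r : ZMod D) else 0) * (ArithmeticFunction.moebius e : ℂ) := by
    intro r
    have hμ := Literature.Algebra.EuclideanLattices.sum_divisors_moebius_eq_ite (r.gcd k)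
    have hdiv : (r.gcd k).divisors = k.divisors.filter (fun e => e ∣ r) := by
      ext e
      simp only [Nat.mem_divisors, Finset.mem_filter, Nat.dvd_gcd_iff, ne_eq, Nat.gcd_eq_zero_iff, hk.ne',
        and_false, not_false_eq_true, and_true]
      tauto
    rw [hdiv, Finset.sum_filter] at hμ
    have hμC : (∑ e ∈ k.divisors, if e ∣ r then (ArithmeticFunction.moebius e : ℂ) else 0)
        = if r.gcd k = 1 then 1 else 0 := by
      have := congr_arg (fun z : ℤ => (z : ℂ)) hμ
      push_cast at this
      exact this
    calc (if Nat.Coprime r k then χ (r : ZMod D) else 0)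
        = χ (r : ZMod D) * ∑ e ∈ k.divisors, (if e ∣ r then (ArithmeticFunction.moebius e : ℂ) else 0) := by
          rw [hμC]; by_cases hc : Nat.Coprime r k <;> simp [hc]
      _ = ∑ e ∈ k.divisors, (if e ∣ r then χ (r : ZMod D) else 0) * (ArithmeticFunction.moebius e : ℂ) := by
          rw [Finset.mul_sum]
          exact Finset.sum_congr rfl fun e _ => by split_ifs <;> simp
  simp_rw [hmask]
  rw [Finset.sum_comm]
  refine Finset.sum_eq_zero fun e he => ?_
  rw [← Finset.sum_mul, sum_range_mul_char_multiples_eq_zero χ hχ (Nat.pos_of_mem_divisors he)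
    (Nat.dvd_of_mem_divisors he), zero_mul]

/-- Tightness of `BandMainVanishes` AS STATED (the card's cheapest falsifier, first kernel-checked by ls-knife-len-idea-1
g10): without `(D,k) = 1` a general `k`-periodic weight need not be orthogonal to `χ` over `[0, D·k)` — `D = k = 3`,
`c = 𝟙_{r ≡ 1 (3)}` gives `3` for every Dirichlet character mod `3`. An `example`, not a theorem about the card. -/
example (χ : DirichletCharacter ℂ 3) :
    ∑ r ∈ Finset.range (3 * 3), χ (r : ZMod 3) * (if (r : ZMod 3) = 1 then 1 else 0) = 3 := by
  obtain ⟨h3, h4, h5, h6, h7, h8⟩ : (3 : ZMod 3) = 0 ∧ (4 : ZMod 3) = 1 ∧ (5 : ZMod 3) = 2 ∧ (6 : ZMod 3) = 0 ∧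
      (7 : ZMod 3) = 1 ∧ (8 : ZMod 3) = 2 := by decide
  have h0 : (0 : ZMod 3) ≠ 1 := by decide
  have h2 : (2 : ZMod 3) ≠ 1 := by decide
  simp [Finset.sum_range_succ, h3, h4, h5, h6, h7, h8, h0, h2]
  norm_num

end Band

/-! ### Part 5 — Pólya–Vinogradov along a progression (the band's analytic input) -/

section Progression

/-- **The card's P3, general-weight form (PROVED from the tree's engine p445477):** for `χ` primitive mod `D ≥ 2`, a step
`e`, a window `(X, Y]` and a weight with `sup ‖b(e·)‖ ≤ B` and variation `Σ‖b(e(n+1)) − b(en)‖ ≤ V` on it,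
`‖Σ_{X<n≤Y} χ(e·n)·b(e·n)‖ ≤ √D·(1 + log D)·(B + V)` — the χ-twisted long profile variable `u = e·u′` of the band,
constrained only by `e ∣ u`, is Pólya–Vinogradov-small (`χ(e) = 0` disposes of `(e,D) ≠ 1`); for the smooth weight
`g(log u/log P)`, `V ≤ (log Y − log X)/log P` (cf. `KnifeEdgeInvisibleTail`). [cite: MontgomeryVaughan2007, Thm 9.18] -/
theorem norm_sum_Ioc_char_progression_mul_le {D : ℕ} (hD : 2 ≤ D) {χ : DirichletCharacter ℂ D}
    (hχ : χ.IsPrimitive) (e : ℕ) (b : ℕ → ℂ) {X Y : ℕ} (hXY : X ≤ Y) {B V : ℝ} (hB : 0 ≤ B) (hV : 0 ≤ V)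
    (hb : ∀ n ∈ Ioc X Y, ‖b (e * n)‖ ≤ B) (hv : ∑ n ∈ Ico X Y, ‖b (e * (n + 1)) - b (e * n)‖ ≤ V) :
    ‖∑ n ∈ Ioc X Y, χ ((e * n : ℕ) : ZMod D) * b (e * n)‖ ≤ Real.sqrt D * (1 + Real.log D) * (B + V) := by
  have hsplit : ∀ n ∈ Ioc X Y, χ ((e * n : ℕ) : ZMod D) * b (e * n)
      = χ (e : ZMod D) * (χ (n : ZMod D) * (fun m => b (e * m)) n) := by
    intro n _
    rw [Nat.cast_mul, map_mul, mul_assoc]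
  rw [Finset.sum_congr rfl hsplit, ← Finset.mul_sum, norm_mul]
  have hengine := KnifeEdgeInvisibleTail.norm_sum_Ioc_char_mul_le hD hχ (fun m => b (e * m)) hXY hB hV hb
    (by simpa [Nat.mul_succ] using hv)
  calc ‖χ (e : ZMod D)‖ * ‖∑ n ∈ Ioc X Y, χ (n : ZMod D) * b (e * n)‖
      ≤ 1 * (Real.sqrt D * (1 + Real.log D) * (B + V)) :=
        mul_le_mul (DirichletCharacter.norm_le_one χ _) hengine (norm_nonneg _) zero_le_one
    _ = Real.sqrt D * (1 + Real.log D) * (B + V) := one_mul _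

end Progression

end Literature.NumberTheory.LFunctions.Zhang2022.KnifeEdge.LongLegSplit

end
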